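import Summits.ValiantsHypothesis.ValiantsHypothesis.Theses.DivisionGap
import Summits.ValiantsHypothesis.ValiantsHypothesis.Theorems.DivisionGapZeroOneTransferStubUniformOfZot

/-!
# Crux `DivisionGap.ZeroOneTransfer` (stmt-ValiantsHypothesis-5066), line `charged-uncharged` —
registered stub `uniformOfMm` (twin of the skeleton stub `stub_uniformOfMm`): THE UNCHARGED CHILD
`MonotoneMultiples` IMPLIES ITS UNIFORM FORM (finiteness + diagonal)

**Claim settled** (stub C6 of the lead's skeleton, TRUE): the uncharged child MM of the crux —
every 0/1-coefficient family over `ℝ≥0` whose complexification is a `VP_ℂ` family has a constant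
`c` and, at every level `n`, a nonzero `h` with `L₊(f_n·h) ≤ 2^((log₂ n + c)^c)` (the cofactor
`h` is NOT charged) — implies its UNIFORM form: for every exponent `e` ONE constant `c` such that
every 0/1 polynomial `f` over `ℝ≥0` in a finite variable type of size `≤ n^e + e`, of total degree
`≤ n^e + e` and of `ℂ`-complexity `≤ n^e + e`, has a nonzero `h` with
`L₊(f·h) ≤ 2^((log₂ n + c)^c)`.

Proof: verbatim the finiteness + diagonal argument of stub C2 (`stub_uniformOfZot`, file
`Theorems/DivisionGapZeroOneTransferStubUniformOfZot.lean`) with the predicate "good at `(n, c)`"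
changed from `L₊(g h) + L₊(h) ≤ 2^((log₂ n + c)^c)` to `L₊(g h) ≤ 2^((log₂ n + c)^c)`.  Only two
helpers of that file mention the predicate and are re-proved here in the uncharged form
(namespace `UniformOfMm`): `le_of_not_good` (the certificate `h = 1` bounds the violated constants
at a level) and `good_of_good_rename` (certificates pull back along injective renamings at no
cost, `stub_divSubstClosure` with free substituends); the others (`threshold_mono`,
`exists_worst`, `complexity_le_of_totalDegree_le`, `exists_injective_fin`, `exists_retraction`,
`coeff_rename_zero_or_one`, `complexity_map_rename_le`) are reused as they stand.

Unconditional (axioms `propext`, `Classical.choice`, `Quot.sound`). References: [Burgisser2000]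
Defs. 2.1–2.4 (the classes); the statement is folklore bookkeeping (compactness of the constant).
-/

set_option linter.dupNamespace false

namespace Summit.ValiantsHypothesis.ValiantsHypothesis.Theorems.DivisionGapZeroOneTransfer

open MvPolynomial Literature.Computability.AlgebraicComplexity
open Summit.ValiantsHypothesis.ValiantsHypothesis.Theses.DivisionGap
open scoped NNReal

namespace UniformOfMm

/-- **Bounded violation at a level** (uncharged form).  If a polynomial over `ℝ≥0` in `N`
variables of total degree `≤ N` has NO nonzero `h` with `L(g h) ≤ 2 ^ ((a + c) ^ c)`, then
`c ≤ 2 T T + 2 T`, `T = (N + 1) ^ N + N`: otherwise `h = 1` is such a certificate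
(`L(g · 1) = L(g) ≤ 2 T T + 2 T < c ≤ 2 ^ ((a + c) ^ c)`). [folklore] -/
theorem le_of_not_good {N : ℕ} (g : MvPolynomial (Fin N) ℝ≥0) (hdeg : g.totalDegree ≤ N)
    {a c : ℕ} (hng : ¬ ∃ h : MvPolynomial (Fin N) ℝ≥0, h ≠ 0 ∧
      complexity (g * h) ≤ 2 ^ ((a + c) ^ c)) :
    c ≤ 2 * ((N + 1) ^ N + N) * ((N + 1) ^ N + N) + 2 * ((N + 1) ^ N + N) := by
  by_contra hlt
  refine hng ⟨1, one_ne_zero, ?_⟩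
  rw [mul_one]
  exact ((UniformOfZot.complexity_le_of_totalDegree_le g hdeg).trans (not_le.mp hlt).le).trans
    (UniformOfZot.le_threshold a c)

/-- **Certificates pull back along injective renamings at no cost** (uncharged form).  If
`rename ι f` has a nonzero `h` with `L(rename ι f · h) ≤ B` then so does `f`: transport along the
free retraction of `ι` (`stub_divSubstClosure` with `Σ_j L(ρ j) = 0`, and
`aeval ρ (rename ι f) = aeval (ρ ∘ ι) f = aeval X f = f`). [folklore] -/
theorem good_of_good_rename {τ κ : Type} [Fintype κ] {ι : τ → κ} (hι : Function.Injective ι)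
    (f : MvPolynomial τ ℝ≥0) {B : ℕ}
    (hg : ∃ h : MvPolynomial κ ℝ≥0, h ≠ 0 ∧ complexity (rename ι f * h) ≤ B) :
    ∃ h : MvPolynomial τ ℝ≥0, h ≠ 0 ∧ complexity (f * h) ≤ B := by
  obtain ⟨ρ, hρX, hρ0⟩ := UniformOfZot.exists_retraction ι hι
  obtain ⟨h', hh', hle⟩ := hg
  obtain ⟨h, hh, h1, -⟩ := stub_divSubstClosure κ τ (rename ι f) ρ h' hh'
  have hsum : ∑ j, complexity (ρ j) = 0 := Finset.sum_eq_zero fun j _ => hρ0 j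
  have hf : aeval ρ (rename ι f) = f := by
    rw [aeval_rename, show ρ ∘ ι = X from funext hρX, aeval_X_left_apply]
  rw [hsum, add_zero, hf] at h1
  exact ⟨h, hh, h1.trans hle⟩

end UniformOfMm

/-- **Stub C6 — `MonotoneMultiples` implies its uniform form** (finiteness + diagonal, as Stub
C2 `stub_uniformOfZot` without the `L₊(h)` term).  Fix `e`; call a polynomial over `ℝ≥0` in
`Fin (n^e+e)` ADMISSIBLE at level `n` if it has 0/1 coefficients, total degree `≤ n^e + e` and
`ℂ`-complexity `≤ n^e + e`, and GOOD at `(n, c)` if some nonzero `h` has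
`L₊(g h) ≤ 2^((log₂ n + c)^c)`.  (i) FINITENESS: every admissible `g` is good at every `c` beyond
an explicit `D n` (certificate `h = 1`: `g` has `≤ (n^e+e+1)^(n^e+e)` monomials, so
`stub_sparsePolyComplexity` bounds `L₊(g)`, and `c ≤ 2^((log₂ n + c)^c)`), so the constants
violated at level `n` are bounded.  (ii) DIAGONAL: let `F n` be an admissible violator of the
LARGEST violated constant at level `n` (`Nat.sSup_mem`; `0` if nothing is violated); by
monotonicity of `2^((log₂ n + c)^c)` in `c`, `F n` violates every constant violated at level `n`.
`n ↦ F n` is a 0/1 family in `Fin (n^e+e)` variables of degree and `ℂ`-complexity `≤ n^e + e`,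
hence `IsVPFamily` over `ℂ` (`#Fin (n^e+e) = n^e+e`, `deg (map φ g) ≤ deg g`); the hypothesis MM
gives it ONE constant `c₀`, so NO admissible polynomial violates `c₀` at any level.
(iii) REDUCTION TO `Fin (n^e+e)`: a general `f` in `τ`, `#τ ≤ n^e + e`, renames injectively into
`Fin (n^e + e)`; 0/1 coefficients (`coeff_rename_mapDomain` / `coeff_rename_eq_zero`), the degree
bound (`totalDegree_rename_le`) and the `ℂ`-complexity bound (`complexity_rename_le` after
`map_rename`) persist, and a certificate for `rename ι f` pulls back to `f` along the free
retraction `Fin (n^e+e) → {X t} ∪ {1}` (`stub_divSubstClosure`, all substituends of complexity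
`0`); so `f` is good at `c₀`. [folklore] -/
theorem uniformOfMm :
    (∀ (σ : ℕ → Type) [∀ n, Fintype (σ n)] (f : ∀ n, MvPolynomial (σ n) NNReal),
      (∀ n m, MvPolynomial.coeff m (f n) = 0 ∨ MvPolynomial.coeff m (f n) = 1) →
      Literature.Computability.AlgebraicComplexity.IsVPFamily
        (fun n => MvPolynomial.map (Complex.ofRealHom.comp NNReal.toRealHom) (f n)) →
      ∃ c : ℕ, ∀ n, ∃ h : MvPolynomial (σ n) NNReal, h ≠ 0 ∧
        Literature.Computability.AlgebraicComplexity.complexity (f n * h) ≤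
          2 ^ ((Nat.log 2 n + c) ^ c)) →
    (∀ e : ℕ, ∃ c : ℕ, ∀ (n : ℕ) (τ : Type) [Fintype τ] (f : MvPolynomial τ NNReal),
      (∀ m, MvPolynomial.coeff m f = 0 ∨ MvPolynomial.coeff m f = 1) →
      Fintype.card τ ≤ n ^ e + e → f.totalDegree ≤ n ^ e + e →
      Literature.Computability.AlgebraicComplexity.complexity
        (MvPolynomial.map (Complex.ofRealHom.comp NNReal.toRealHom) f) ≤ n ^ e + e →
      ∃ h : MvPolynomial τ NNReal, h ≠ 0 ∧
        Literature.Computability.AlgebraicComplexity.complexity (f * h) ≤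
          2 ^ ((Nat.log 2 n + c) ^ c)) := by
  intro hM e
  -- DIAGONAL: at every level `n` a worst admissible polynomial in `Fin (n ^ e + e)` variables
  have key : ∀ n : ℕ, ∃ g : MvPolynomial (Fin (n ^ e + e)) ℝ≥0,
      ((∀ m, coeff m g = 0 ∨ coeff m g = 1) ∧ g.totalDegree ≤ n ^ e + e ∧
        complexity (map (Complex.ofRealHom.comp NNReal.toRealHom) g) ≤ n ^ e + e) ∧
      ∀ c : ℕ, (∃ g' : MvPolynomial (Fin (n ^ e + e)) ℝ≥0,
          ((∀ m, coeff m g' = 0 ∨ coeff m g' = 1) ∧ g'.totalDegree ≤ n ^ e + e ∧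
            complexity (map (Complex.ofRealHom.comp NNReal.toRealHom) g') ≤ n ^ e + e) ∧
          ¬ ∃ h : MvPolynomial (Fin (n ^ e + e)) ℝ≥0, h ≠ 0 ∧
            complexity (g' * h) ≤ 2 ^ ((Nat.log 2 n + c) ^ c)) →
        ¬ ∃ h : MvPolynomial (Fin (n ^ e + e)) ℝ≥0, h ≠ 0 ∧
          complexity (g * h) ≤ 2 ^ ((Nat.log 2 n + c) ^ c) := by
    intro n
    refine UniformOfZot.exists_worst _ _ _ (fun g c c' hcc' ⟨h, hh, hle⟩ =>
      ⟨h, hh, hle.trans (UniformOfZot.threshold_mono _ hcc')⟩)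
      (fun g hg c hng => UniformOfMm.le_of_not_good g hg.2.1 hng) (a₀ := 0) ⟨?_, ?_, ?_⟩
    · exact fun m => Or.inl (coeff_zero m)
    · rw [totalDegree_zero]; exact Nat.zero_le _
    · rw [map_zero, ← C_0, complexity_C_holds]; exact Nat.zero_le _
  choose F hF using key
  -- the diagonal family is a 0/1 `VP_ℂ` family; the hypothesis MM gives it ONE constant `c₀`
  obtain ⟨c₀, hc₀⟩ := hM (fun n => Fin (n ^ e + e)) F (fun n => (hF n).1.1)
    ⟨⟨⟨e, fun n => (Fintype.card_fin _).le⟩,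
      ⟨e, fun n => le_trans (Finset.sup_mono (support_map_subset _ _)) (hF n).1.2.1⟩⟩,
      ⟨e, fun n => (hF n).1.2.2⟩⟩
  -- `c₀` is the uniform constant: a violator renames into `Fin (n ^ e + e)` and stays a violator
  refine ⟨c₀, fun n τ _ f h01 hcard hdeg hcx => ?_⟩
  by_contra hbad
  obtain ⟨ι, hι⟩ := UniformOfZot.exists_injective_fin hcard
  exact (hF n).2 c₀ ⟨rename ι f, ⟨UniformOfZot.coeff_rename_zero_or_one hι h01,
      (totalDegree_rename_le ι f).trans hdeg,
      (UniformOfZot.complexity_map_rename_le _ ι f).trans hcx⟩,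
    fun hg => hbad (UniformOfMm.good_of_good_rename hι f hg)⟩ (hc₀ n)

end Summit.ValiantsHypothesis.ValiantsHypothesis.Theorems.DivisionGapZeroOneTransfer
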